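import Summits.AtomisticToContinuum.HydrodynamicLimit.Theorems.MourreKoopmanChargesStressStrongMixingStaticClusteringMoments
import Summits.AtomisticToContinuum.HydrodynamicLimit.Theorems.MourreKoopmanChargesStressStrongMixingGibbsTranslation
import Literature.MathematicalPhysics.KineticTheory.HardSphereDLRBridge
import HarnessLib

/-!
# `StressStrongMixing` · line `birth`, stub I4 `stub_windowFourthMoments`:
# fourth moments of the window energy statistic under a translation-invariant hard-sphere Gibbs state

Support file for the crux item stmt-AtomisticToContinuum-9584 (`StressStrongMixing`, route `MourreKoopmanCharges` of
`AtomisticToContinuum/HydrodynamicLimit`), line `birth`, registered stub `stub_windowFourthMoments` (I4):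

  for `σ, z, θ > 0` and a translation-invariant hard-sphere Gibbs state `μ` at `(σ, z, θ⁻¹)` there is `C` with
  `S_L⁴ ∈ L¹(μ)` and `E_μ[S_L⁴] ≤ C (1 + L)^{12}` for all `L > 0`, where
  `S_L(ω) = Σ_{(q,v) ∈ ω, q ∈ B(0,L)} (1 + ‖v‖²)` is the window energy statistic (`windowEnergyStat` of the skeleton).

Proof (a cover of the ball by unit cells and translation invariance; no smallness, no density hypothesis):
* integrability of `S_L⁴`, and of `X_a⁴` for every shifted cell statistic
  `X_a(ω) = Σ_{(q,v) ∈ ω, q + a ∈ [0,1)³} (1 + ‖v‖²)`, is the landed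
  `integrable_pow_four_linStat_of_isHardSphereGibbs` (`|1_Λ(q)(1 + ‖v‖²)| ≤ (1 + ‖v‖)²`);
* `μ`-a.e. configuration is a hard-sphere configuration (`HardSphereDLR.ae_isHardCore_of_isHardSphereGibbs`), hence
  has finitely many particles above every bounded window (`IsHardCore.posLocallyFinite`); on such configurations the
  linear statistics are finite sums, so `0 ≤ S_L ≤ Σ_{k ∈ G} X_k` for the grid `G = {-N, …, N}³` of integer shifts,
  `N = ⌈L⌉₊` (the cells `[0,1)³ - k`, `k ∈ G`, cover `B(0, L)`), and `S_L⁴ ≤ |G|³ Σ_k X_k⁴` (Cauchy–Schwarz twice);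
* `X_a = X_0 ∘ τ_a` (`linStat_spatialShift`) and `μ ∘ τ_a⁻¹ = μ`, so `E[X_a⁴] = E[X_0⁴] =: M`, whence
  `E[S_L⁴] ≤ |G|⁴ M = (2N+1)^{12} M ≤ 27⁴ M (1 + L)^{12}`.

References: D. Ruelle, *Statistical Mechanics: Rigorous Results* (1969), §4.2 (local moments of Gibbs states);
H. Spohn, *Large Scale Dynamics of Interacting Particles* (1991), Part I §7.1.
-/

noncomputable section

open MeasureTheory ProbabilityTheory Filter Topology
open scoped ENNReal

namespace Summit.AtomisticToContinuum.HydrodynamicLimit.Theorems.MourreKoopmanChargesStressStrongMixing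

open Literature.MathematicalPhysics.KineticTheory Literature.Analysis.FluidPDE
open Literature.Analysis.FunctionSpaces (PointConfig maxwellianBeta)

/-! ### Linear statistics: sign, finite sums, covers, shifts -/

section LinStat

/-- A linear statistic of a non-negative one-particle function is non-negative (a `finsum` of non-negative terms,
or the junk value `0`). [folklore] -/
theorem linStat_nonneg {f : V3 × V3 → ℝ} (hf : ∀ p, 0 ≤ f p) (ω : MarkedConfig) : 0 ≤ linStat f ω := by
  rw [linStat_def]
  exact finsum_nonneg fun p => finsum_nonneg fun _ => hf p

/-- **A linear statistic supported over `Λ` is a finite sum over the particles above any larger window `B`**, on a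
configuration with finitely many particles above `B`. [folklore] -/
theorem linStat_eq_sum_of_finite_particlesIn {f : V3 × V3 → ℝ} {Λ B : Set V3}
    (hfΛ : ∀ p : V3 × V3, p.1 ∉ Λ → f p = 0) (hΛB : Λ ⊆ B) {ω : MarkedConfig} (hfin : (particlesIn ω B).Finite) :
    linStat f ω = ∑ p ∈ hfin.toFinset, f p := by
  rw [linStat_def]
  refine finsum_mem_eq_sum_of_subset f ?_ ?_
  · rintro p ⟨hp, hfp⟩
    rw [Set.Finite.coe_toFinset]
    refine ⟨hp, hΛB ?_⟩
    by_contra h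
    exact hfp (hfΛ p h)
  · intro p hp
    rw [Set.Finite.coe_toFinset] at hp
    exact hp.1

/-- **Monotonicity under a cover**: if the cells `cell k`, `k ∈ K`, cover `Λ`, then for a non-negative weight `g` and
a configuration with finitely many particles above a window `B` containing `Λ` and the cells,
`Σ_{q ∈ Λ} g ≤ Σ_{k ∈ K} Σ_{q ∈ cell k} g`. [folklore] -/
theorem linStat_indicator_le_sum_of_cover {ι : Type*} (K : Finset ι) (cell : ι → Set V3) {Λ B : Set V3}
    (hcover : ∀ q ∈ Λ, ∃ k ∈ K, q ∈ cell k) (hΛB : Λ ⊆ B) (hcB : ∀ k ∈ K, cell k ⊆ B)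
    {g : V3 × V3 → ℝ} (hg : ∀ p, 0 ≤ g p) {ω : MarkedConfig} (hfin : (particlesIn ω B).Finite) :
    linStat (fun p => Λ.indicator (fun _ => g p) p.1) ω ≤
      ∑ k ∈ K, linStat (fun p => (cell k).indicator (fun _ => g p) p.1) ω := by
  have hK : ∀ k ∈ K, linStat (fun p => (cell k).indicator (fun _ => g p) p.1) ω =
      ∑ p ∈ hfin.toFinset, (cell k).indicator (fun _ => g p) p.1 := fun k hk =>
    linStat_eq_sum_of_finite_particlesIn (fun p hp => Set.indicator_of_notMem hp _) (hcB k hk) hfin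
  rw [linStat_eq_sum_of_finite_particlesIn (fun p hp => Set.indicator_of_notMem hp _) hΛB hfin,
    Finset.sum_congr rfl hK, Finset.sum_comm]
  refine Finset.sum_le_sum fun p _ => ?_
  have h0 : ∀ k, 0 ≤ (cell k).indicator (fun _ => g p) p.1 := fun k =>
    Set.indicator_nonneg (fun _ _ => hg p) _
  by_cases hp : p.1 ∈ Λ
  · obtain ⟨k, hkK, hpk⟩ := hcover p.1 hp
    rw [Set.indicator_of_mem hp]
    calc g p = (cell k).indicator (fun _ => g p) p.1 := (Set.indicator_of_mem hpk fun _ => g p).symm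
      _ ≤ ∑ k ∈ K, (cell k).indicator (fun _ => g p) p.1 :=
          Finset.single_le_sum (f := fun k => (cell k).indicator (fun _ => g p) p.1) (fun k _ => h0 k) hkK
  · rw [Set.indicator_of_notMem hp]
    exact Finset.sum_nonneg fun k _ => h0 k

/-- **Linear statistics under spatial shifts**: `A_f(τ_x ω) = A_{f(· + (x, 0))}(ω)` (the shift is injective on
particles). [folklore] -/
theorem linStat_spatialShift (f : V3 × V3 → ℝ) (x : V3) (ω : MarkedConfig) :
    linStat f (spatialShift x ω) = linStat (fun p => f (p + (x, 0))) ω := by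
  -- adapted from `ChargeClustering.cellObs_comp_spatialShift_eq_linStat` (…OneBodyCompletenessChargeClustering.lean)
  simp only [spatialShift_apply, linStat, PointConfig.coe_eq_carrier, PointConfig.carrier_translate]
  exact finsum_mem_image (add_left_injective _).injOn

end LinStat

/-! ### The energy statistic of a window -/

section Energy

/-- The window energy integrand `(q, v) ↦ 1_Λ(q) (1 + ‖v‖²)` is measurable for a measurable window. [folklore] -/
theorem measurable_indicator_one_add_norm_sq {Λ : Set V3} (hΛ : MeasurableSet Λ) :
    Measurable fun p : V3 × V3 => Λ.indicator (fun _ => 1 + ‖p.2‖ ^ 2) p.1 := by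
  have e : (fun p : V3 × V3 => Λ.indicator (fun _ => 1 + ‖p.2‖ ^ 2) p.1) =
      (Prod.fst ⁻¹' Λ).indicator fun p => 1 + ‖p.2‖ ^ 2 := by
    funext p
    by_cases hp : p.1 ∈ Λ
    · simp [hp]
    · simp [hp]
  rw [e]
  exact (measurable_const.add (measurable_snd.norm.pow_const 2)).indicator (hΛ.preimage measurable_fst)

/-- **The fourth power of the energy statistic of a bounded measurable window is integrable** under every
hard-sphere Gibbs state (`|1_Λ(q)(1 + ‖v‖²)| ≤ (1 + ‖v‖)²` and `integrable_pow_four_linStat_of_isHardSphereGibbs`).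
[folklore] -/
theorem integrable_pow_four_linStat_indicator_one_add_norm_sq {σ z θ : ℝ} (hz : 0 ≤ z) (hθ : 0 < θ)
    {μ : Measure MarkedConfig} (hμ : IsHardSphereGibbs σ z θ⁻¹ (0 : V3) μ) {Λ : Set V3} (hΛ : MeasurableSet Λ)
    (hΛb : Bornology.IsBounded Λ) :
    Integrable (fun ω => (linStat (fun p => Λ.indicator (fun _ => 1 + ‖p.2‖ ^ 2) p.1) ω) ^ 4) μ :=
  integrable_pow_four_linStat_of_isHardSphereGibbs hz hθ hμ hΛ hΛb (measurable_indicator_one_add_norm_sq hΛ)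
    (C := 1) (n := 2)
    (fun p => by
      by_cases hp : p.1 ∈ Λ
      · simp only [Set.indicator_of_mem hp, one_mul]
        rw [abs_of_nonneg (by positivity)]
        nlinarith [norm_nonneg p.2]
      · rw [Set.indicator_of_notMem hp, abs_zero]
        positivity)
    (fun p hp => Set.indicator_of_notMem hp _)

/-- **The energy statistic of a shifted cell is the cell energy statistic after a spatial shift**:
`X_{[0,1)³ - a} = X_{[0,1)³} ∘ τ_a`. [folklore] -/
theorem linStat_indicator_preimage_add_unitCell (a : V3) (ω : MarkedConfig) :
    linStat (fun p => ((· + a) ⁻¹' unitCell).indicator (fun _ => 1 + ‖p.2‖ ^ 2) p.1) ω =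
      linStat (fun p => unitCell.indicator (fun _ => 1 + ‖p.2‖ ^ 2) p.1) (spatialShift a ω) := by
  rw [linStat_spatialShift]
  congr 1
  funext p
  simp only [Prod.fst_add, Prod.snd_add, add_zero]
  by_cases h : p.1 + a ∈ unitCell
  · rw [Set.indicator_of_mem h, Set.indicator_of_mem (show p.1 ∈ (· + a) ⁻¹' unitCell from h)]
  · rw [Set.indicator_of_notMem h, Set.indicator_of_notMem (show p.1 ∉ (· + a) ⁻¹' unitCell from h)]

/-- **Translation invariance of the cell fourth moments**: under a translation-invariant law,
`E[X_{[0,1)³ - a}⁴] = E[X_{[0,1)³}⁴]` for every shift `a ∈ ℝ³`. [folklore] -/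
theorem integral_pow_four_linStat_shiftedCell_eq {μ : Measure MarkedConfig} (hti : IsTranslationInvariant μ)
    (a : V3) :
    ∫ ω, (linStat (fun p => ((· + a) ⁻¹' unitCell).indicator (fun _ => 1 + ‖p.2‖ ^ 2) p.1) ω) ^ 4 ∂μ =
      ∫ ω, (linStat (fun p => unitCell.indicator (fun _ => 1 + ‖p.2‖ ^ 2) p.1) ω) ^ 4 ∂μ := by
  simp_rw [linStat_indicator_preimage_add_unitCell a]
  have hmeas : AEStronglyMeasurable
      (fun ω => (linStat (fun p => unitCell.indicator (fun _ => 1 + ‖p.2‖ ^ 2) p.1) ω) ^ 4)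
      (μ.map (spatialShift a)) :=
    ((measurable_linStat (measurable_indicator_one_add_norm_sq measurableSet_unitCell)).pow_const
      4).aestronglyMeasurable
  have hmap : μ.map (spatialShift a) = μ := hti a
  calc ∫ ω, (linStat (fun p => unitCell.indicator (fun _ => 1 + ‖p.2‖ ^ 2) p.1) (spatialShift a ω)) ^ 4 ∂μ
      = ∫ ω, (linStat (fun p => unitCell.indicator (fun _ => 1 + ‖p.2‖ ^ 2) p.1) ω) ^ 4
          ∂(μ.map (spatialShift a)) :=
        (integral_map (PointConfig.measurable_translate _).aemeasurable hmeas).symm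
    _ = ∫ ω, (linStat (fun p => unitCell.indicator (fun _ => 1 + ‖p.2‖ ^ 2) p.1) ω) ^ 4 ∂μ := by rw [hmap]

end Energy

/-! ### The grid of integer shifts covering a ball -/

section Grid

/-- **The unit cells `[0,1)³ - k`, `k ∈ {-N, …, N}³`, cover the ball `B(0, L)` once `L ≤ N`** (take `k = -⌊q⌋`
coordinatewise). [folklore] -/
theorem exists_shift_mem_unitCell {L : ℝ} {N : ℕ} (hLN : L ≤ N) {q : V3} (hq : q ∈ Metric.ball (0 : V3) L) :
    ∃ k ∈ Fintype.piFinset fun _ : Fin 3 => Finset.Icc (-(N : ℤ)) N,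
      q + (WithLp.toLp 2 fun i => ((k i : ℤ) : ℝ)) ∈ unitCell := by
  have hqi : ∀ i, |q i| < L := fun i => by
    have h1 : ‖q i‖ ≤ ‖q‖ := PiLp.norm_apply_le q i
    rw [Real.norm_eq_abs] at h1
    exact h1.trans_lt (mem_ball_zero_iff.1 hq)
  refine ⟨fun i => -⌊q i⌋, Fintype.mem_piFinset.2 fun i => Finset.mem_Icc.2 ⟨?_, ?_⟩, fun i => ?_⟩
  · have h : ⌊q i⌋ ≤ (N : ℤ) := Int.floor_le_iff.2 (by push_cast; linarith [(abs_lt.1 (hqi i)).2])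
    show -(N : ℤ) ≤ -⌊q i⌋
    omega
  · have h : -(N : ℤ) ≤ ⌊q i⌋ := Int.le_floor.2 (by push_cast; linarith [(abs_lt.1 (hqi i)).1])
    show -⌊q i⌋ ≤ (N : ℤ)
    omega
  · simp only [PiLp.add_apply, Int.cast_neg]
    rw [← sub_eq_add_neg, Int.self_sub_floor]
    exact ⟨Int.fract_nonneg _, Int.fract_lt_one _⟩

/-- The grid `{-N, …, N}³` has `(2N + 1)³` points. [folklore] -/
theorem card_piFinset_Icc_neg (N : ℕ) :
    ((Fintype.piFinset fun _ : Fin 3 => Finset.Icc (-(N : ℤ)) N).card : ℝ) = (2 * N + 1 : ℝ) ^ 3 := by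
  rw [Fintype.card_piFinset, Finset.prod_const, Finset.card_univ, Fintype.card_fin, Int.card_Icc]
  have h : ((N : ℤ) + 1 - -(N : ℤ)).toNat = 2 * N + 1 := by omega
  rw [h]
  push_cast
  ring

end Grid

/-! ### The registered stub -/

/-- **I4 · WindowFourthMoments** (registered stub `stub_windowFourthMoments` of the skeleton, `= WindowFourthMoments`
expanded): under every translation-invariant hard-sphere Gibbs state at `(σ, z, θ⁻¹)`, `σ, z, θ > 0`, the window energy
statistic `S_L = Σ_{q ∈ B(0,L)} (1 + ‖v_q‖²)` has `S_L⁴ ∈ L¹` and `E[S_L⁴] ≤ C (1 + L)^{12}` for all `L > 0`, with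
`C = 27⁴ · E[X_{[0,1)³}⁴]` (cover of the ball by the `(2⌈L⌉₊ + 1)³ ≤ 27 (1 + L)³` unit cells of the integer grid,
Cauchy–Schwarz twice, translation invariance; the a.e. hard core makes all statistics finite sums). [folklore] -/
theorem stub_windowFourthMoments :
    ∀ σ z θ : ℝ, 0 < σ → 0 < z → 0 < θ → ∀ μ : Measure MarkedConfig, IsHardSphereGibbs σ z θ⁻¹ (0 : V3) μ →
      IsTranslationInvariant μ → ∃ C : ℝ, ∀ L : ℝ, 0 < L →
        Integrable (fun ω => (linStat (fun p => (Metric.ball (0 : V3) L).indicator (fun _ => 1 + ‖p.2‖ ^ 2) p.1) ω) ^ 4) μ ∧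
        ∫ ω, (linStat (fun p => (Metric.ball (0 : V3) L).indicator (fun _ => 1 + ‖p.2‖ ^ 2) p.1) ω) ^ 4 ∂μ ≤ C * (1 + L) ^ 12 := by
  intro σ z θ hσ hz hθ μ hG hti
  -- the fourth moment of the unit-cell energy statistic
  set M : ℝ := ∫ ω, (linStat (fun p => unitCell.indicator (fun _ => 1 + ‖p.2‖ ^ 2) p.1) ω) ^ 4 ∂μ with hM
  have hM0 : 0 ≤ M := integral_nonneg fun ω => by positivity
  refine ⟨27 ^ 4 * M, fun L hL => ?_⟩
  have hSint : Integrable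
      (fun ω => (linStat (fun p => (Metric.ball (0 : V3) L).indicator (fun _ => 1 + ‖p.2‖ ^ 2) p.1) ω) ^ 4) μ :=
    integrable_pow_four_linStat_indicator_one_add_norm_sq hz.le hθ hG measurableSet_ball Metric.isBounded_ball
  refine ⟨hSint, ?_⟩
  -- the grid of integer shifts, the shifted cells and their energy statistics
  set N : ℕ := ⌈L⌉₊ with hN
  set G : Finset (Fin 3 → ℤ) := Fintype.piFinset fun _ : Fin 3 => Finset.Icc (-(N : ℤ)) N with hGdef
  set kvec : (Fin 3 → ℤ) → V3 := fun k => WithLp.toLp 2 fun i => ((k i : ℤ) : ℝ) with hkvec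
  set cell : (Fin 3 → ℤ) → Set V3 := fun k => (· + kvec k) ⁻¹' unitCell with hcell
  set X : (Fin 3 → ℤ) → MarkedConfig → ℝ := fun k =>
    linStat (fun p => (cell k).indicator (fun _ => 1 + ‖p.2‖ ^ 2) p.1) with hX
  have hXint : ∀ k, Integrable (fun ω => X k ω ^ 4) μ := fun k =>
    integrable_pow_four_linStat_indicator_one_add_norm_sq hz.le hθ hG
      ((measurable_add_const (kvec k)) measurableSet_unitCell)
      (isBounded_preimage_add_const isBounded_unitCell (kvec k))
  have hXM : ∀ k, ∫ ω, X k ω ^ 4 ∂μ = M := fun k => integral_pow_four_linStat_shiftedCell_eq hti (kvec k)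
  have hLN : L ≤ N := Nat.le_ceil L
  have hcard : (G.card : ℝ) ≤ 27 * (1 + L) ^ 3 := by
    rw [hGdef, card_piFinset_Icc_neg N]
    have hN1 : (N : ℝ) < L + 1 := Nat.ceil_lt_add_one hL.le
    have h2 : (2 * N + 1 : ℝ) ≤ 3 * (1 + L) := by linarith
    calc (2 * N + 1 : ℝ) ^ 3 ≤ (3 * (1 + L)) ^ 3 := pow_le_pow_left₀ (by positivity) h2 3
      _ = 27 * (1 + L) ^ 3 := by ring
  -- Cauchy–Schwarz twice over the grid (cf. `pow_four_sum_le` of `…StaticClusteringMoments.lean`, over `Fin k`)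
  have hCS : ∀ a : (Fin 3 → ℤ) → ℝ, (∑ k ∈ G, a k) ^ 4 ≤ (G.card : ℝ) ^ 3 * ∑ k ∈ G, a k ^ 4 := fun a => by
    have h1 : (∑ k ∈ G, a k) ^ 2 ≤ G.card * ∑ k ∈ G, a k ^ 2 := sq_sum_le_card_mul_sum_sq
    have h2 : (∑ k ∈ G, a k ^ 2) ^ 2 ≤ G.card * ∑ k ∈ G, (a k ^ 2) ^ 2 := sq_sum_le_card_mul_sum_sq
    calc (∑ k ∈ G, a k) ^ 4 = ((∑ k ∈ G, a k) ^ 2) ^ 2 := by ring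
      _ ≤ ((G.card : ℝ) * ∑ k ∈ G, a k ^ 2) ^ 2 := pow_le_pow_left₀ (sq_nonneg _) h1 2
      _ = (G.card : ℝ) ^ 2 * (∑ k ∈ G, a k ^ 2) ^ 2 := by ring
      _ ≤ (G.card : ℝ) ^ 2 * (G.card * ∑ k ∈ G, (a k ^ 2) ^ 2) := mul_le_mul_of_nonneg_left h2 (by positivity)
      _ = (G.card : ℝ) ^ 3 * ∑ k ∈ G, a k ^ 4 := by
          rw [show (G.card : ℝ) ^ 3 = (G.card : ℝ) ^ 2 * G.card by ring, mul_assoc]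
          congr 2
          exact Finset.sum_congr rfl fun k _ => by ring
  -- a.e. domination of `S_L⁴` by the cell statistics (a.e. configuration is a hard-sphere configuration)
  have hae : ∀ᵐ ω ∂μ,
      (linStat (fun p => (Metric.ball (0 : V3) L).indicator (fun _ => 1 + ‖p.2‖ ^ 2) p.1) ω) ^ 4 ≤
        (G.card : ℝ) ^ 3 * ∑ k ∈ G, X k ω ^ 4 := by
    filter_upwards [HardSphereDLR.ae_isHardCore_of_isHardSphereGibbs hG] with ω hω
    have hB : Bornology.IsBounded (Metric.ball (0 : V3) L ∪ ⋃ k ∈ G, cell k) :=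
      Metric.isBounded_ball.union
        ((Bornology.isBounded_biUnion_finset G).2 fun k _ => isBounded_preimage_add_const isBounded_unitCell (kvec k))
    have hfin : (particlesIn ω (Metric.ball (0 : V3) L ∪ ⋃ k ∈ G, cell k)).Finite :=
      (hω.posLocallyFinite hσ).finite_particlesIn hB
    have hle : linStat (fun p => (Metric.ball (0 : V3) L).indicator (fun _ => 1 + ‖p.2‖ ^ 2) p.1) ω ≤
        ∑ k ∈ G, X k ω :=
      linStat_indicator_le_sum_of_cover G cell (fun q hq => exists_shift_mem_unitCell hLN hq) Set.subset_union_left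
        (fun k hk => (Set.subset_iUnion₂ (s := fun k (_ : k ∈ G) => cell k) k hk).trans Set.subset_union_right)
        (fun p => by positivity) hfin
    have h0 : 0 ≤ linStat (fun p => (Metric.ball (0 : V3) L).indicator (fun _ => 1 + ‖p.2‖ ^ 2) p.1) ω :=
      linStat_nonneg (fun p => Set.indicator_nonneg (fun _ _ => by positivity) _) ω
    calc (linStat (fun p => (Metric.ball (0 : V3) L).indicator (fun _ => 1 + ‖p.2‖ ^ 2) p.1) ω) ^ 4
        ≤ (∑ k ∈ G, X k ω) ^ 4 := pow_le_pow_left₀ h0 hle 4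
      _ ≤ (G.card : ℝ) ^ 3 * ∑ k ∈ G, X k ω ^ 4 := hCS fun k => X k ω
  calc ∫ ω, (linStat (fun p => (Metric.ball (0 : V3) L).indicator (fun _ => 1 + ‖p.2‖ ^ 2) p.1) ω) ^ 4 ∂μ
      ≤ ∫ ω, (G.card : ℝ) ^ 3 * ∑ k ∈ G, X k ω ^ 4 ∂μ :=
        integral_mono_ae hSint ((integrable_finsetSum G fun k _ => hXint k).const_mul _) hae
    _ = (G.card : ℝ) ^ 3 * ((G.card : ℝ) * M) := by
        rw [integral_const_mul, integral_finsetSum G fun k _ => hXint k, Finset.sum_congr rfl fun k _ => hXM k,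
          Finset.sum_const, nsmul_eq_mul]
    _ = (G.card : ℝ) ^ 4 * M := by ring
    _ ≤ (27 * (1 + L) ^ 3) ^ 4 * M :=
        mul_le_mul_of_nonneg_right (pow_le_pow_left₀ (Nat.cast_nonneg _) hcard 4) hM0
    _ = 27 ^ 4 * M * (1 + L) ^ 12 := by ring

end Summit.AtomisticToContinuum.HydrodynamicLimit.Theorems.MourreKoopmanChargesStressStrongMixing

end
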